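import Summits.ResolutionOfSingularities.ResolutionOfSingularities.Theorems.EquisingularLiftEquisingularLiftNatP1VBLiftSection
import Literature.AlgebraicGeometry.Morphisms.CechH1ProjectiveFinite
import Literature.AlgebraicGeometry.Modules.SerreTwistCharts
import Literature.AlgebraicGeometry.Motives.ProjBaseChangeAny
import HarnessLib

/-!
# [OURS · L1 W4.5(b) · T-P1VB part 3] The projective line: `Ȟ¹(ℙ¹_k; g^*F) = 0 ⇒ H⁰(ℙ¹_A, F) → H⁰(ℙ¹_k, g^*F)` is onto

Cell res-hironaka, LADDER-RESOLUTION rung L (D-0089), slot W4.5(b), crux `Theses.EquisingularLift.EquisingularLiftNat`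
(stmt-ResolutionOfSingularities-20038) / child `EquisingularLiftNatThree` (stmt-ResolutionOfSingularities-20148); object **T-P1VB**
(res-L1-w45b-lead-2 BOOK 2026-08-27T09:28:20Z; RE 09:47:33Z «GO (b) the LIFT THEOREM first, in the [Čech] currency of (a) on the two
standard charts»), `--supports stmt-ResolutionOfSingularities-20148 --as helper`. NOT a statement of any manuscript; OURS.
AI-written; AI review is weaker than expert review.

WHAT. The instance `X = ℙ¹_A` of part 2b (`…P1VBLiftSection.exists_unitSection_eq`), in the EL♮ chain's spelling of projective
space (`ProjCech.PP A 1 = Proj (homogeneousSubmodule (Fin 2) A)`, structure map `ProjCech.toSpec A 1 = projToSpec (Fin 2) A =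
Proj.toSpecZero ≫ Spec (A → A[x]₀)`, special-fibre inclusion `g = Proj.map (mapGraded A k (Fin 2)) _ : ℙ¹_k → ℙ¹_A`, the
tree's base-change square `Motives/ProjBaseChangeAny.isPullback_projMap'` and properness `isProper_projToSpec`):
* `isAffineOpen_Dplus_singleton`, `isAffineOpen_Dplus_singleton_inf`, `iSup_Dplus_singleton_eq_top` — the standard charts
  `D₊(x_i) = ProjCech.Dplus A r {i}` of `𝐏ʳ_A` are affine with affine pairwise intersections and cover;
* `projMap_preimage_Dplus` — `g⁻¹ D₊(X_s) = D₊(X_s)` (`Proj.map_preimage_basicOpen` + `map (∏ x_i) = ∏ x_i`);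
* **`exists_unitSection_eq_projectiveLine`** — for `A` Noetherian LOCAL, `A → k` onto a non-zero ring (the residue field),
  `F` a vector bundle on `ℙ¹_A` with `Subsingleton (CechMH1 (toSpec k 1) (g^*F) (fun i : Fin 2 => Dplus k 1 {i}))`
  (= «Ȟ¹ of the restriction on the two standard charts of `ℙ¹_k` vanishes», the v8 DOWNSTAIRS hypothesis in the spelling
  lead-2 accepted 09:47:33Z; part 2a `subsingleton_cechMH1_iff` unfolds it), every global section of `g^*F` is `η(s)` for a
  global section `s` of `F`. No completeness of `A`.

References (index only): Hartshorne III.12.11 (cohomology and base change), III.5 (standard cover of `𝐏ʳ`); tree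
`Morphisms/CechH1ProjectiveFinite` (`iSup_cover_eq_top`), `Modules/SerreTwistCharts` (`Dplus_union`).
-/

noncomputable section

open CategoryTheory AlgebraicGeometry TopologicalSpace Opposite
open Literature.AlgebraicGeometry.Morphisms Literature.AlgebraicGeometry.Modules Literature.AlgebraicGeometry
open Literature.Algebra.Homology.LaurentCech (Xs Xs_mem Xs_singleton)
open Literature.AlgebraicGeometry.Motives.ProjBaseChangeRing (mapGraded mapGraded_apply irrelevant_le_map
  isPullback_projMap' isProper_projToSpec)

universe u

attribute [local instance] MvPolynomial.gradedAlgebra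

set_option linter.dupNamespace false -- mandated namespace `Summit.<Summit>.<Problem>` of this single-conjunct summit

namespace Summit.ResolutionOfSingularities.ResolutionOfSingularities.Cruxes.EquisingularLiftNat.P1VB

/-! ### The standard charts of `𝐏ʳ`: affine, covering, preserved by base change -/

section Charts

variable (A : Type u) [CommRing A] (r : ℕ)

/-- The standard charts `D₊(x_i)` of `𝐏ʳ_A` are affine. [folklore] -/
theorem isAffineOpen_Dplus_singleton (i : Fin (r + 1)) : IsAffineOpen (ProjCech.Dplus A r {i}) :=
  Proj.isAffineOpen_basicOpen _ _ (Xs_mem {i}) (by rw [Finset.card_singleton]; exact one_pos)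

/-- `D₊(x_i) ∩ D₊(x_j) = D₊(x_i x_j)` is affine. [folklore] -/
theorem isAffineOpen_Dplus_singleton_inf (i j : Fin (r + 1)) :
    IsAffineOpen (ProjCech.Dplus A r {i} ⊓ ProjCech.Dplus A r {j}) := by
  rw [← SerreTwist.Dplus_union]
  exact Proj.isAffineOpen_basicOpen _ _ (Xs_mem _)
    (Finset.card_pos.mpr ⟨i, Finset.mem_union_left _ (Finset.mem_singleton_self i)⟩)

/-- The standard charts cover `𝐏ʳ_A`. [folklore] -/
theorem iSup_Dplus_singleton_eq_top : ⨆ i : Fin (r + 1), ProjCech.Dplus A r {i} = ⊤ :=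
  ProjCech.iSup_cover_eq_top (𝟙 (ProjCech.PP A r))

variable (k : Type u) [CommRing k] [Algebra A k]

/-- **Base change preserves the standard charts**: for `g = Proj(A[x] → k[x]) : 𝐏ʳ_k → 𝐏ʳ_A`,
`g⁻¹ D₊(X_s) = D₊(X_s)`. [folklore] -/
theorem projMap_preimage_Dplus (s : Finset (Fin (r + 1))) :
    Proj.map (mapGraded A k (Fin (r + 1))) (irrelevant_le_map A k (Fin (r + 1))) ⁻¹ᵁ ProjCech.Dplus A r s =
      ProjCech.Dplus k r s := by
  change Proj.basicOpen _ (mapGraded A k (Fin (r + 1)) (Xs A s)) = Proj.basicOpen _ (Xs k s)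
  congr 1
  rw [mapGraded_apply]
  unfold Xs
  rw [map_prod]
  exact Finset.prod_congr rfl fun i _ => MvPolynomial.map_X _ i

end Charts

/-! ### The projective line over a local ring: sections lift from the special fibre -/

section ProjectiveLine

variable {A k : Type u} [CommRing A] [IsNoetherianRing A] [IsLocalRing A] [CommRing k] [Nontrivial k]
  [Algebra A k]

/-- **T-P1VB on `ℙ¹`**: let `A` be Noetherian local, `A → k` a surjection onto a non-zero ring (the residue
field), `g : ℙ¹_k → ℙ¹_A` the special-fibre inclusion `Proj (A[x₀,x₁] → k[x₀,x₁])`, `F` a vector bundle on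
`ℙ¹_A` whose restriction `g^*F` has `Ȟ¹ = 0` on the two standard charts `D₊(x₀), D₊(x₁)` of `ℙ¹_k`. Then every
global section of `g^*F` is the pull-back `η(s)` of a global section `s` of `F`:
`H⁰(ℙ¹_A, F) → H⁰(ℙ¹_k, F_k)` is onto. [folklore] -/
theorem exists_unitSection_eq_projectiveLine (hπ : Function.Surjective (algebraMap A k))
    (F : (ProjCech.PP A 1).Modules) (hF : Motives.IsVectorBundle F)
    (h1 : Subsingleton (CechMH1 (ProjCech.toSpec k 1)
      ((Scheme.Modules.pullback (Proj.map (mapGraded A k (Fin 2)) (irrelevant_le_map A k (Fin 2)))).obj F)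
      (fun i : Fin 2 => ProjCech.Dplus k 1 {i})))
    (s₀ : Γ((Scheme.Modules.pullback (Proj.map (mapGraded A k (Fin 2)) (irrelevant_le_map A k (Fin 2)))).obj F,
      Proj.map (mapGraded A k (Fin 2)) (irrelevant_le_map A k (Fin 2)) ⁻¹ᵁ ⊤)) :
    ∃ s : Γ(F, ⊤), unitSection (Proj.map (mapGraded A k (Fin 2)) (irrelevant_le_map A k (Fin 2))) F ⊤ s = s₀ := by
  haveI : IsProper (ProjCech.toSpec A 1) := isProper_projToSpec (Fin 2) A
  have hcharts : (fun i : Fin 2 => Proj.map (mapGraded A k (Fin 2)) (irrelevant_le_map A k (Fin 2)) ⁻¹ᵁ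
      ProjCech.Dplus A 1 {i}) = fun i : Fin 2 => ProjCech.Dplus k 1 {i} :=
    funext fun i => projMap_preimage_Dplus A 1 k {i}
  have h1' : Subsingleton (CechMH1 (ProjCech.toSpec k 1)
      ((Scheme.Modules.pullback (Proj.map (mapGraded A k (Fin 2)) (irrelevant_le_map A k (Fin 2)))).obj F)
      (fun i : Fin 2 => Proj.map (mapGraded A k (Fin 2)) (irrelevant_le_map A k (Fin 2)) ⁻¹ᵁ
        ProjCech.Dplus A 1 {i})) := by
    rw [hcharts]; exact h1
  exact exists_unitSection_eq (ProjCech.toSpec A 1) (fun i : Fin 2 => ProjCech.Dplus A 1 {i}) (algebraMap A k) F hπ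
    (isPullback_projMap' A k) hF (fun i => isAffineOpen_Dplus_singleton A 1 i)
    (isAffineOpen_Dplus_singleton_inf A 1 0 1) (iSup_Dplus_singleton_eq_top A 1) h1' s₀

end ProjectiveLine

end Summit.ResolutionOfSingularities.ResolutionOfSingularities.Cruxes.EquisingularLiftNat.P1VB

end
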